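import Literature.NumberTheory.Automorphic.SmoothIndOpenCellHaarFunctional   -- ★ §1 `Representation.apply_eq_zero_of_mk_coinvariants_eq_zero` (invariant functional kills zero classes), §4 `ParabolicTriple.mk_restrict_eq_zero_iff`; brings ★ `JacquetModule` (`normalizedJacquet`)
import HarnessLib

/-!
# F0 · P3c · line LH6 «StCharTS» — «JACQUET SPLIT TEST★» (generic base layer): an `N`-invariant functional on an `N`-stable subspace whose Jacquet image is a LINE
# DETECTS the class (`[v] = 0 ⟺ Λ v = 0`), hence «`r_P(m)[f₀] = χ(m)[f₀]` ⟺ `Λ(δ_P^{-1/2}(m)·ρ(m)f₀ − χ(m)·f₀) = 0`» [BernsteinZelevinsky1977 Prop. 1.9 (a), §2.3; Casselman1995 §3.2, §6.3]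

Cell `pub/hodgecm-mathlib`, crux H413 = `stmt-HodgeConjecture-24833` (lane `--supports … --as helper`), route HCCMUnconditional; seat F0P2-p06 (g20); a GENERIC brick under LEAD
F0P3a-plan (g15) STANDING RULE 20 (T14-67: theorems-only base layer, no road ∕ organ ∕ rider).  THEOREMS ONLY (0 def ∕ 0 instance ∕ 0 notation ∕ 0 sorry); ★-only imports.

WHAT (any topological group `G`, parabolic triple `t = (P, M, N)` with `N` the union of its compact open subgroups, `ρ` a SMOOTH representation of `G` on `V`, Jacquet-module carrier
`(t.restrict ρ).Coinvariants`, normalised action ★ `Representation.normalizedJacquet`):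
* §1 **`apply_eq_zero_of_mk_restrict_eq_zero`** — ★ `Representation.apply_eq_zero_of_mk_coinvariants_eq_zero` [BZ77 Prop. 1.9 (a)] read on the parabolic carrier (★ `mk_restrict_eq_zero_iff`):
  an `N`-invariant linear functional `Λ` on an `N`-stable subspace `S ≤ V` kills every `v ∈ S` with `[v] = 0`.
* §2 **`mk_restrict_eq_zero_iff_apply_eq_zero`** — the DETECTOR: if moreover `Λ ≠ 0` and the classes of `S` lie in a submodule `ℓ` of the Jacquet module with `dim ℓ ≤ 1` (the closed-cell
  kernel line of ★ `F0P3U3PrincipalSeriesJacquetClosedCell` ∕ the open-cell bound of ★ N1 are the intended instances), then for `v ∈ S`: `[v] = 0 ⟺ Λ v = 0`.  (If `Λ v = 0 ≠ [v]`: pick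
  `w ∈ S` with `Λ w ≠ 0`; on the line, `[w] = c[v]`, so `[w − c v] = 0`, so `Λ w = c Λ v = 0` by §1.)
* §3 **`ker_stable_of_eigenfunctional`**, **`sub_smul_mem_ker_of_eigenfunctional`**, **`normalizedJacquet_mk_eq_smul_iff`** — for a `(P, χ δ_P^{1/2})`-eigenfunctional `ev` (`δ_P^{1/2}|_N = 1`)
  the kernel `S = ker ev` is `N`-stable and contains `g₀ := δ_P^{-1/2}(m)·ρ(m) f₀ − χ(m)·f₀` (`m ∈ M`, any `f₀`); since `r_P(m)[f₀] − χ(m)[f₀] = [g₀]` (★ `normalizedJacquet_mk`), §2 gives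
  THE SPLIT TEST «`r_P(m)[f₀] = χ(m)·[f₀]` ⟺ `Λ(g₀) = 0`» for every `N`-invariant `Λ ≠ 0` on `ker ev` whose classes lie on a line.
CONSUMER-IN-WAITING (rule 20): MEMO `F0/P2/F0P2-p06/g20/MEMO-KEYS3-analytic-road.v2` brick T3 — with `ρ = i_G(χ)` on `U(Φ₃)(L⁺_v)`, `ev = ev₁`, `Λ` = the ★ open-cell Haar functional, `ℓ` = the
closed-cell kernel line, and the one-vector ∕ finite-order tests of F0P2-p02 (g24)'s «CHAR-EXT COCYCLE★» (T1), it turns RUNG 0's named input `hKeysRed3` (Keys1984 §7 Thm. (1)) into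
«ONE cell integral vanishes»; no census row yet — reusable for any rank-one Jacquet module with a closed-cell line.  Nothing here is specific to `U(3)`.
HONEST LABEL: HC_CM is proved only modulo the 7 printed citations (2 remaining named inputs: hLiu418 = `stmt-HodgeConjecture-24832`, h413 = `stmt-HodgeConjecture-24833`) until rung 0 closes;
count-neutral generic brick.

## References
* [BernsteinZelevinsky1977] I. N. Bernstein, A. V. Zelevinsky, Ann. Sci. ÉNS 10 (1977), Prop. 1.9 (a) (exactness of coinvariants), §2.3 (normalised functors), Geometrical Lemma 2.12.
* [Casselman1995] W. Casselman, *Introduction to the theory of admissible representations of p-adic reductive groups* (1995), §3.2 Prop. 3.2.3, §6.3 (Bruhat filtration of `i_P σ|_P`).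
-/

set_option autoImplicit false
-- the mandated namespace has the single-problem summit's repeated segment (`HodgeConjecture.HodgeConjecture`)
set_option linter.dupNamespace false

noncomputable section

open Literature.NumberTheory.Automorphic

namespace Summit.HodgeConjecture.HodgeConjecture.Cruxes.H413.F0P3cStCharTSJacquetSplitTest

variable {G : Type*} [Group G] [TopologicalSpace G] [IsTopologicalGroup G] (t : ParabolicTriple G)
  {V : Type*} [AddCommGroup V] [Module ℂ V]

/-! ## §1 An `N`-invariant functional on an `N`-stable subspace kills the vectors with zero Jacquet class -/

/-- **[BernsteinZelevinsky1977, Prop. 1.9 (a)] on the Jacquet-module carrier `(t.restrict ρ).Coinvariants`**: `N` the union of its compact open subgroups, `ρ` smooth, `S ≤ V`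
stable under `ρ(N)`, `Λ : S → ℂ` linear with `Λ(ρ(n) v) = Λ v` (`n ∈ N`); then `[v] = 0 ⟹ Λ v = 0` for `v ∈ S` (★ `Representation.apply_eq_zero_of_mk_coinvariants_eq_zero` for the
restriction `ρ ∘ N.subtype`, carried over by ★ `ParabolicTriple.mk_restrict_eq_zero_iff`). [cite: BernsteinZelevinsky1977, Prop. 1.9 (a)] -/
theorem apply_eq_zero_of_mk_restrict_eq_zero (hN : IsLimitOfCompactOpen ↥t.N) (ρ : Representation ℂ G V) (hρ : ρ.IsSmooth)
    (S : Submodule ℂ V) (hS : ∀ (n : G), n ∈ t.N → ∀ ⦃v : V⦄, v ∈ S → ρ n v ∈ S) (lam : S →ₗ[ℂ] ℂ)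
    (hlam : ∀ (n : G) (hn : n ∈ t.N) (v : S), lam ⟨ρ n v, hS n hn v.2⟩ = lam v) (v : S)
    (hv : Representation.Coinvariants.mk (t.restrict ρ) (v : V) = 0) : lam v = 0 := by
  rw [ParabolicTriple.mk_restrict_eq_zero_iff] at hv
  have hρN : Representation.IsSmooth (ρ.comp t.N.subtype) := fun w => (hρ w).preimage continuous_subtype_val
  exact Representation.apply_eq_zero_of_mk_coinvariants_eq_zero (ρ := ρ.comp t.N.subtype) hN hρN S
    (fun n w hw => hS n n.2 hw) lam (fun n w => hlam n n.2 w) v hv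

/-! ## §2 The detector: on a line, `[v] = 0 ⟺ Λ v = 0` -/

/-- **The `N`-invariant functional DETECTS the class on a line.**  As in §1, with `Λ ≠ 0` and all classes `[v]`, `v ∈ S`, inside a submodule `ℓ` of the Jacquet module with
`dim ℓ ≤ 1`: for `v ∈ S`, `[v] = 0 ⟺ Λ v = 0`. [cite: BernsteinZelevinsky1977, Prop. 1.9 (a), §2.3] [cite: Casselman1995, §6.3] -/
theorem mk_restrict_eq_zero_iff_apply_eq_zero (hN : IsLimitOfCompactOpen ↥t.N) (ρ : Representation ℂ G V) (hρ : ρ.IsSmooth)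
    (S : Submodule ℂ V) (hS : ∀ (n : G), n ∈ t.N → ∀ ⦃v : V⦄, v ∈ S → ρ n v ∈ S) (lam : S →ₗ[ℂ] ℂ)
    (hlam : ∀ (n : G) (hn : n ∈ t.N) (v : S), lam ⟨ρ n v, hS n hn v.2⟩ = lam v) (hlam0 : lam ≠ 0)
    (ℓ : Submodule ℂ (t.restrict ρ).Coinvariants) [FiniteDimensional ℂ ↥ℓ] (hℓ1 : Module.finrank ℂ ↥ℓ ≤ 1)
    (hℓ : ∀ v ∈ S, Representation.Coinvariants.mk (t.restrict ρ) v ∈ ℓ) (v : S) :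
    Representation.Coinvariants.mk (t.restrict ρ) (v : V) = 0 ↔ lam v = 0 := by
  refine ⟨apply_eq_zero_of_mk_restrict_eq_zero t hN ρ hρ S hS lam hlam v, fun hv0 => ?_⟩
  by_contra hne
  -- a vector of `S` on which `Λ` does not vanish
  obtain ⟨w, hw⟩ : ∃ w : S, lam w ≠ 0 := by
    by_contra h
    push Not at h
    exact hlam0 (LinearMap.ext fun w => by rw [h w, LinearMap.zero_apply])
  -- on the line `ℓ`: `[w] = c • [v]`
  obtain ⟨u, hu⟩ := finrank_le_one_iff.1 hℓ1
  obtain ⟨a, ha⟩ := hu ⟨_, hℓ v v.2⟩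
  obtain ⟨b, hb⟩ := hu ⟨_, hℓ w w.2⟩
  have ha0 : a ≠ 0 := by
    rintro rfl
    apply hne
    have h := congrArg Subtype.val ha
    rw [zero_smul] at h
    exact h.symm
  have hwv : Representation.Coinvariants.mk (t.restrict ρ) (w : V) = (b * a⁻¹) • Representation.Coinvariants.mk (t.restrict ρ) (v : V) := by
    have hv' : Representation.Coinvariants.mk (t.restrict ρ) (v : V) = a • (u : (t.restrict ρ).Coinvariants) := by
      have h := congrArg Subtype.val ha; exact h.symm
    have hw' : Representation.Coinvariants.mk (t.restrict ρ) (w : V) = b • (u : (t.restrict ρ).Coinvariants) := by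
      have h := congrArg Subtype.val hb; exact h.symm
    rw [hv', hw', smul_smul, mul_assoc, inv_mul_cancel₀ ha0, mul_one]
  -- `[w − c v] = 0`, so `Λ w = c Λ v = 0` by §1 — contradiction
  have hz : Representation.Coinvariants.mk (t.restrict ρ) ((w - (b * a⁻¹) • v : S) : V) = 0 := by
    rw [Submodule.coe_sub, Submodule.coe_smul, map_sub, map_smul, hwv, sub_self]
  have h := apply_eq_zero_of_mk_restrict_eq_zero t hN ρ hρ S hS lam hlam _ hz
  rw [map_sub, map_smul, hv0, smul_zero, sub_zero] at h
  exact hw h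

/-! ## §3 The split test for a `(P, χ δ_P^{1/2})`-eigenfunctional -/

section Normalized

variable [LocallyCompactSpace t.P]

/-- **The kernel of a `(P, χ δ_P^{1/2})`-eigenfunctional is `N`-stable** (`χ(proj n) = 1`, `δ_P^{1/2}(n) = 1` for `n ∈ N`). [cite: BernsteinZelevinsky1977, §1.8, §2.3] -/
theorem ker_stable_of_eigenfunctional (hδ : ∀ (n : G) (hn : n ∈ t.N), rootDeltaChar t.P ⟨n, t.N_le hn⟩ = 1) (χ : t.M →* ℂˣ)
    (ρ : Representation ℂ G V) (ev : V →ₗ[ℂ] ℂ)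
    (hev : ∀ (p : t.P) (v : V), ev (ρ p v) = ((χ (t.proj p) : ℂˣ) : ℂ) * ((rootDeltaChar t.P p : ℂˣ) : ℂ) * ev v) :
    ∀ (n : G), n ∈ t.N → ∀ ⦃v : V⦄, v ∈ LinearMap.ker ev → ρ n v ∈ LinearMap.ker ev := by
  intro n hn v hv
  rw [LinearMap.mem_ker] at hv ⊢
  have h := hev ⟨n, t.N_le hn⟩ v
  rw [t.proj_apply_of_mem_N _ hn, map_one, hδ n hn, Units.val_one, one_mul, one_mul, hv] at h
  exact h

/-- **`N`-invariance of the eigenfunctional itself** (same computation): `ev (ρ n v) = ev v` for `n ∈ N`. [cite: BernsteinZelevinsky1977, §1.8, §2.3] -/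
theorem eigenfunctional_apply_of_mem_N (hδ : ∀ (n : G) (hn : n ∈ t.N), rootDeltaChar t.P ⟨n, t.N_le hn⟩ = 1) (χ : t.M →* ℂˣ)
    (ρ : Representation ℂ G V) (ev : V →ₗ[ℂ] ℂ)
    (hev : ∀ (p : t.P) (v : V), ev (ρ p v) = ((χ (t.proj p) : ℂˣ) : ℂ) * ((rootDeltaChar t.P p : ℂˣ) : ℂ) * ev v)
    (n : G) (hn : n ∈ t.N) (v : V) : ev (ρ n v) = ev v := by
  have h := hev ⟨n, t.N_le hn⟩ v
  rw [t.proj_apply_of_mem_N _ hn, map_one, hδ n hn, Units.val_one, one_mul, one_mul] at h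
  exact h

/-- **The test vector lies in the kernel**: for `m ∈ M` and any `f₀`, `g₀ := δ_P^{-1/2}(m)·ρ(m) f₀ − χ(m)·f₀ ∈ ker ev` (`ev(ρ(m) f₀) = χ(m) δ_P^{1/2}(m) ev f₀`).
[cite: BernsteinZelevinsky1977, §2.3] -/
theorem sub_smul_mem_ker_of_eigenfunctional (χ : t.M →* ℂˣ) (ρ : Representation ℂ G V) (ev : V →ₗ[ℂ] ℂ)
    (hev : ∀ (p : t.P) (v : V), ev (ρ p v) = ((χ (t.proj p) : ℂˣ) : ℂ) * ((rootDeltaChar t.P p : ℂˣ) : ℂ) * ev v)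
    (m : t.M) (f₀ : V) :
    (((rootDeltaChar t.P (Subgroup.inclusion t.M_le m))⁻¹ : ℂˣ) : ℂ) • ρ (m : G) f₀ - ((χ m : ℂˣ) : ℂ) • f₀ ∈ LinearMap.ker ev := by
  rw [LinearMap.mem_ker, map_sub, map_smul, map_smul, smul_eq_mul, smul_eq_mul]
  have hm := hev (Subgroup.inclusion t.M_le m) f₀
  have hproj : t.proj (Subgroup.inclusion t.M_le m) = m := Subtype.ext (t.proj_apply_of_mem_M _ m.2)
  rw [hproj] at hm
  have hcoe : ((Subgroup.inclusion t.M_le m : t.P) : G) = (m : G) := rfl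
  rw [← hcoe, hm, ← mul_assoc, ← mul_assoc, mul_right_comm _ ((χ m : ℂˣ) : ℂ), ← Units.val_mul, inv_mul_cancel, Units.val_one, one_mul, sub_self]

/-- **«JACQUET SPLIT TEST★».**  `ev` a `(P, χ δ_P^{1/2})`-eigenfunctional on the smooth `ρ` (`δ_P^{1/2}|_N = 1`), `Λ ≠ 0` an `N`-invariant functional on `ker ev` whose Jacquet classes lie in a
submodule `ℓ` with `dim ℓ ≤ 1` (the closed-cell line).  Then for every `m ∈ M` and every `f₀`:
**`r_P(m) [f₀] = χ(m) · [f₀]` ⟺ `Λ (δ_P^{-1/2}(m)·ρ(m) f₀ − χ(m)·f₀) = 0`** — the `M`-action on the Jacquet module is the scalar `χ(m)` at `[f₀]` iff ONE number vanishes.  With the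
one-vector ∕ finite-order tests for self-extensions of a character this decides whether a rank-one Jacquet module with equal exponents SPLITS. [cite: BernsteinZelevinsky1977, Prop. 1.9 (a), §2.3]
[cite: Casselman1995, §3.2 Prop. 3.2.3, §6.3] -/
theorem normalizedJacquet_mk_eq_smul_iff (hN : IsLimitOfCompactOpen ↥t.N) (ρ : Representation ℂ G V) (hρ : ρ.IsSmooth)
    (χ : t.M →* ℂˣ) (S : Submodule ℂ V) (hS : ∀ (n : G), n ∈ t.N → ∀ ⦃v : V⦄, v ∈ S → ρ n v ∈ S) (lam : S →ₗ[ℂ] ℂ)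
    (hlam : ∀ (n : G) (hn : n ∈ t.N) (v : S), lam ⟨ρ n v, hS n hn v.2⟩ = lam v) (hlam0 : lam ≠ 0)
    (ℓ : Submodule ℂ (t.restrict ρ).Coinvariants) [FiniteDimensional ℂ ↥ℓ] (hℓ1 : Module.finrank ℂ ↥ℓ ≤ 1)
    (hℓ : ∀ v ∈ S, Representation.Coinvariants.mk (t.restrict ρ) v ∈ ℓ) (m : t.M) (f₀ : V)
    (hg₀ : (((rootDeltaChar t.P (Subgroup.inclusion t.M_le m))⁻¹ : ℂˣ) : ℂ) • ρ (m : G) f₀ - ((χ m : ℂˣ) : ℂ) • f₀ ∈ S) :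
    ρ.normalizedJacquet t m (Representation.Coinvariants.mk (t.restrict ρ) f₀) =
        ((χ m : ℂˣ) : ℂ) • Representation.Coinvariants.mk (t.restrict ρ) f₀ ↔
      lam ⟨_, hg₀⟩ = 0 := by
  rw [← mk_restrict_eq_zero_iff_apply_eq_zero t hN ρ hρ S hS lam hlam hlam0 ℓ hℓ1 hℓ ⟨_, hg₀⟩, Representation.normalizedJacquet_mk,
    ← sub_eq_zero, map_sub, map_smul, map_smul]

end Normalized

end Summit.HodgeConjecture.HodgeConjecture.Cruxes.H413.F0P3cStCharTSJacquetSplitTest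

end
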